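import Literature.NumberTheory.NumberFields.CyclotomicFieldFourPrimaryCongruence
import Literature.NumberTheory.NumberFields.CyclotomicFieldFourNormConjugation
import Literature.NumberTheory.NumberFields.CyclotomicFieldFourClassNumber
import Literature.NumberTheory.NumberFields.UnitRankZeroPowerClasses
import Mathlib.RingTheory.DedekindDomain.AdicValuation
import HarnessLib

/-!
# Explicit Gaussian primes `a + bζ₄` and valuation certificates in `ℤ[i] = 𝓞_{ℚ(ζ₄)}`

PROOF-ONLY file (theorems only, no definition, no named fact, no `sorry`), topic
`Literature/NumberTheory/NumberFields`, namespace `Literature.NumberTheory.NumberFields`.  Carrier: any field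
`K` with `IsCyclotomicExtension {4} ℚ K` and a primitive fourth root of unity `ζ ∈ 𝓞 K` (`𝓞 K = ℤ[ζ] = ℤ[i]`),
as in `CyclotomicFieldFourPrimes` / `CyclotomicFieldFourNormConjugation` / `CyclotomicFieldFourPrimaryCongruence`.
What the sequel (`EllipticCurves/KubertTateFiveMuDescentGaussianMatrix` and its instances) needs in order to
EVALUATE the Kummer coordinates `v(f_T(P)) mod 5` of explicit `ℚ(i)`-points at explicit Gaussian primes:

* §1 `prime_of_norm_eq_prime` — an algebraic integer of `ℚ(i)` whose norm is a rational prime is a prime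
  element (Ireland–Rosen Ch. 9 §7, proof of Lemma 5: `N(π) = p` prime ⟹ `π` irreducible; `ℤ[i]` is a PID);
  **`prime_int_add_int_mul_four`** — `a² + b² = ℓ` prime ⟹ `a + bζ` is prime («`p = ππ̄`, `π = a + bi`»).
* §2 places: `asIdeal_eq_span_of_prime_mem` (a finite place containing a prime element `π` IS `(π)`),
  `exists_asIdeal_eq_span` (the place `(π)`), `natCast_dvd_of_intCast_mem` (`v ∋ ℓ`, `v ∋ d ∈ ℤ` ⟹ `ℓ ∣ d`),
  **`mem_or_mem_of_sq_add_sq_eq`** (a place above `ℓ = a² + b²` contains `a + bζ` or `a - bζ`),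
  **`int_sub_int_mul_not_mem_span`** (`a - bζ ∉ (a + bζ)` for odd `ℓ`: the two places above a split prime are
  distinct, Lemma 5 «`(π) ≠ (π̄)`» in coordinates — `a - bζ = -(a + bζ) + 2a` with `ℓ ∤ 2a`).
* §3 valuation certificates at a principal place `v = (π)`: **`log_valuation_eq_neg_of_eq_pow_mul`**
  (`x = πᵏ·y`, `y ∉ v` ⟹ `v(x) = k`, printed as `log (v.valuation K x) = -k` in Mathlib's multiplicative
  normalisation), **`not_mem_of_eq_mul_add_intCast`** (`y = π z + d`, `d ∈ ℤ`, `ℓ ∤ d`, `ℓ ∈ v` ⟹ `y ∉ v`), and the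
  three integer read-outs `log_valuation_intCast_of_inert` (`q ≡ 3 (4)`: `v(qᵏ w) = k`),
  `log_valuation_intCast_of_split` (`v = (a + bζ)`, `ℓ = a² + b²` odd: `v(ℓᵏ w) = k`) and
  `log_valuation_intCast_of_two` (`v ∋ 2`: `v(2ᵏ w) = 2k` for odd `w`, since `2 = -ζ(1 + ζ)²`).
* §4 `not_isPrimitiveRoot_five_four` — `ℚ(i)` contains no primitive fifth root of unity (`w_{ℚ(i)} = 4`).

## References

* [IrelandRosen1982] K. Ireland, M. Rosen, *A Classical Introduction to Modern Number Theory*, Ch. 9 §7,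
  Lemmas 3–5 and p. 120 (chunk p0127).
* [NeukirchANT1999] J. Neukirch, *Algebraic Number Theory*, Ch. I §3 and §11 (valuations attached to the
  primes of a Dedekind domain).
-/

noncomputable section

namespace Literature.NumberTheory.NumberFields

open NumberField Ideal IsDedekindDomain

section Four

variable {K : Type} [Field K] [NumberField K] [IsCyclotomicExtension {4} ℚ K] {ζ : 𝓞 K}

omit [NumberField K] [IsCyclotomicExtension {4} ℚ K] in
/-- `ζ² + 1 = 0` in `𝓞 K` for a primitive fourth root of unity. [folklore] -/
private theorem sq_add_one_eq_zero (hζ : IsPrimitiveRoot ζ 4) : ζ ^ 2 + 1 = 0 := by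
  rw [(hζ.pow (by norm_num) (show 4 = 2 * 2 by norm_num)).eq_neg_one_of_two_right, neg_add_cancel]

/-! ## §1 Prime elements of `ℤ[i]` from the norm -/

/-- **An algebraic integer of `ℚ(i)` whose norm is a rational prime is a prime element** (`N` is
multiplicative and non-negative, `N(u) = 1` iff `u` is a unit, and `ℤ[i]` is a principal ideal domain).
[cite: IrelandRosen1982, Ch. 9 §7 (p. 120 and proof of Lemma 5)] -/
theorem prime_of_norm_eq_prime {x : 𝓞 K} {ℓ : ℕ} (hℓ : ℓ.Prime) (hx : Algebra.norm ℤ x = ℓ) : Prime x := by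
  haveI : IsPrincipalIdealRing (𝓞 K) := isPrincipalIdealRing_ringOfIntegers_of_isCyclotomicExtension_four K
  have hℓ1 : (ℓ : ℤ) ≠ 1 := by exact_mod_cast hℓ.ne_one
  have hirr : Irreducible x := by
    refine ⟨fun hu ↦ hℓ1 ?_, fun a b hab ↦ ?_⟩
    · rw [← hx]; exact (isUnit_iff_norm_eq_one_four x).mp hu
    · have hN : Algebra.norm ℤ a * Algebra.norm ℤ b = ℓ := by rw [← map_mul, ← hab, hx]
      have ha := norm_nonneg_four a
      have hb := norm_nonneg_four b
      have hℓZ : Prime (ℓ : ℤ) := Nat.prime_iff_prime_int.mp hℓ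
      rcases (hℓZ.irreducible.isUnit_or_isUnit hN.symm) with hua | hub
      · left
        rw [isUnit_iff_norm_eq_one_four]
        rcases Int.isUnit_iff.mp hua with h1 | h1
        · exact h1
        · linarith
      · right
        rw [isUnit_iff_norm_eq_one_four]
        rcases Int.isUnit_iff.mp hub with h1 | h1
        · exact h1
        · linarith
  exact hirr.prime

/-- **`π = a + bζ` with `a² + b² = ℓ` prime is a prime element of `ℤ[i]`** (`N(a + bζ) = a² + b²`).
[cite: IrelandRosen1982, Ch. 9 §7 Lemma 5] -/
theorem prime_int_add_int_mul_four (hζ : IsPrimitiveRoot ζ 4) {a b : ℤ} {ℓ : ℕ} (hℓ : ℓ.Prime)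
    (h : a ^ 2 + b ^ 2 = ℓ) : Prime ((a : 𝓞 K) + b * ζ) :=
  prime_of_norm_eq_prime hℓ (by rw [norm_int_add_int_mul_four hζ a b, h])

/-- `1 + ζ` is a prime element of `ℤ[i]` (`N(1 + ζ) = 2`). [cite: IrelandRosen1982, Ch. 9 §7 Lemma 3] -/
theorem prime_one_add_four (hζ : IsPrimitiveRoot ζ 4) : Prime ((1 : 𝓞 K) + ζ) := by
  have h := prime_int_add_int_mul_four hζ (a := 1) (b := 1) Nat.prime_two (by norm_num)
  simpa using h

/-! ## §2 Places of `ℚ(i)`: principal generators, integers in a place, the two places above a split prime -/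

omit [IsCyclotomicExtension {4} ℚ K] in
/-- A finite place containing a prime element `π` is the place `(π)` (`(π)` is maximal).
[cite: NeukirchANT1999, Ch. I §3] -/
theorem asIdeal_eq_span_of_prime_mem {p : 𝓞 K} (hp : Prime p) {v : HeightOneSpectrum (𝓞 K)}
    (hv : p ∈ v.asIdeal) : v.asIdeal = span {p} := by
  have hmax : (span {p}).IsMaximal :=
    ((span_singleton_prime hp.ne_zero).mpr hp).isMaximal
      (by rw [Ne, span_singleton_eq_bot]; exact hp.ne_zero)
  exact (hmax.eq_of_le v.isPrime.ne_top ((span_singleton_le_iff_mem _).mpr hv)).symm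

omit [NumberField K] [IsCyclotomicExtension {4} ℚ K] in
/-- The place `(π)` of a prime element `π`. [cite: NeukirchANT1999, Ch. I §3] -/
theorem exists_asIdeal_eq_span {p : 𝓞 K} (hp : Prime p) :
    ∃ v : HeightOneSpectrum (𝓞 K), v.asIdeal = span {p} :=
  ⟨⟨span {p}, (span_singleton_prime hp.ne_zero).mpr hp,
    by rw [Ne, span_singleton_eq_bot]; exact hp.ne_zero⟩, rfl⟩

omit [IsCyclotomicExtension {4} ℚ K] in
/-- Two finite places containing the same prime element are equal (both are `(π)`). [cite: NeukirchANT1999, Ch. I §3] -/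
theorem eq_of_mem_of_mem_of_prime {p : 𝓞 K} (hp : Prime p) {v w : HeightOneSpectrum (𝓞 K)}
    (hv : p ∈ v.asIdeal) (hw : p ∈ w.asIdeal) : v = w :=
  HeightOneSpectrum.ext (by rw [asIdeal_eq_span_of_prime_mem hp hv, asIdeal_eq_span_of_prime_mem hp hw])

omit [NumberField K] [IsCyclotomicExtension {4} ℚ K] in
/-- **A rational integer in a place above `ℓ` is divisible by `ℓ`** (`v ∩ ℤ = ℓℤ`: if `ℓ ∤ d` then
`1 = uℓ + wd ∈ v`). [cite: NeukirchANT1999, Ch. I §3] -/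
theorem natCast_dvd_of_intCast_mem {v : HeightOneSpectrum (𝓞 K)} {ℓ : ℕ} (hℓ : ℓ.Prime)
    (hℓv : (ℓ : 𝓞 K) ∈ v.asIdeal) {d : ℤ} (hd : (d : 𝓞 K) ∈ v.asIdeal) : (ℓ : ℤ) ∣ d := by
  by_contra hnd
  have hcop : IsCoprime (ℓ : ℤ) d := (Prime.coprime_iff_not_dvd (Nat.prime_iff_prime_int.mp hℓ)).mpr hnd
  obtain ⟨u, w, huw⟩ := hcop
  have h1 : (1 : 𝓞 K) ∈ v.asIdeal := by
    have : ((u * ℓ + w * d : ℤ) : 𝓞 K) = (u : 𝓞 K) * (ℓ : 𝓞 K) + (w : 𝓞 K) * (d : 𝓞 K) := by push_cast; ring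
    rw [← Int.cast_one, ← huw, this]
    exact v.asIdeal.add_mem (v.asIdeal.mul_mem_left _ hℓv) (v.asIdeal.mul_mem_left _ hd)
  exact v.isPrime.ne_top ((Ideal.eq_top_iff_one _).mpr h1)

omit [NumberField K] [IsCyclotomicExtension {4} ℚ K] in
/-- **A place above `ℓ = a² + b²` contains `a + bζ` or `a - bζ`** (`(a + bζ)(a - bζ) = a² + b² = ℓ`).
[cite: IrelandRosen1982, Ch. 9 §7 Lemma 5] -/
theorem mem_or_mem_of_sq_add_sq_eq (hζ : IsPrimitiveRoot ζ 4) {a b : ℤ} {ℓ : ℕ} (h : a ^ 2 + b ^ 2 = ℓ)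
    {v : HeightOneSpectrum (𝓞 K)} (hv : (ℓ : 𝓞 K) ∈ v.asIdeal) :
    (a : 𝓞 K) + b * ζ ∈ v.asIdeal ∨ (a : 𝓞 K) - b * ζ ∈ v.asIdeal := by
  have hsq := sq_add_one_eq_zero hζ
  have e : ((a : 𝓞 K) + b * ζ) * ((a : 𝓞 K) - b * ζ) = (ℓ : 𝓞 K) := by
    have : ((ℓ : ℤ) : 𝓞 K) = (ℓ : 𝓞 K) := by push_cast; rfl
    rw [← this, ← h]; push_cast
    linear_combination (-(b : 𝓞 K) ^ 2) * hsq
  exact v.isPrime.mem_or_mem (by rw [e]; exact hv)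

/-- **`a - bζ ∉ (a + bζ)` when `ℓ = a² + b²` is an odd prime**: `a - bζ = -(a + bζ) + 2a` and `ℓ ∤ 2a`
(`0 < a² < ℓ`), so the two places above a split prime are distinct («`(π) ≠ (π̄)`»).
[cite: IrelandRosen1982, Ch. 9 §7 Lemma 5] -/
theorem int_sub_int_mul_not_mem_span (hζ : IsPrimitiveRoot ζ 4) {a b : ℤ} {ℓ : ℕ} (hℓ : ℓ.Prime)
    (hℓ2 : ℓ ≠ 2) (h : a ^ 2 + b ^ 2 = ℓ) (hb : b ≠ 0) :
    (a : 𝓞 K) - b * ζ ∉ span {((a : 𝓞 K) + b * ζ)} := by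
  obtain ⟨v, hv⟩ := exists_asIdeal_eq_span (prime_int_add_int_mul_four hζ hℓ h)
  have hπ : (a : 𝓞 K) + b * ζ ∈ v.asIdeal := by rw [hv]; exact mem_span_singleton_self _
  have hℓv : (ℓ : 𝓞 K) ∈ v.asIdeal := by
    have hsq := sq_add_one_eq_zero hζ
    have e : (ℓ : 𝓞 K) = ((a : 𝓞 K) + b * ζ) * ((a : 𝓞 K) - b * ζ) := by
      have : ((ℓ : ℤ) : 𝓞 K) = (ℓ : 𝓞 K) := by push_cast; rfl
      rw [← this, ← h]; push_cast
      linear_combination ((b : 𝓞 K) ^ 2) * hsq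
    rw [e]; exact v.asIdeal.mul_mem_right _ hπ
  rw [← hv]
  intro hmem
  -- `2a = (a - bζ) + (a + bζ) ∈ v`, so `ℓ ∣ 2a`
  have h2a : ((2 * a : ℤ) : 𝓞 K) ∈ v.asIdeal := by
    have : ((2 * a : ℤ) : 𝓞 K) = ((a : 𝓞 K) - b * ζ) + ((a : 𝓞 K) + b * ζ) := by push_cast; ring
    rw [this]; exact v.asIdeal.add_mem hmem hπ
  have hdvd := natCast_dvd_of_intCast_mem hℓ hℓv h2a
  have hℓZ : Prime (ℓ : ℤ) := Nat.prime_iff_prime_int.mp hℓ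
  rcases hℓZ.dvd_or_dvd hdvd with h2 | ha
  · have : ℓ ∣ 2 := by exact_mod_cast h2
    exact hℓ2 ((Nat.prime_dvd_prime_iff_eq hℓ Nat.prime_two).mp this)
  · -- `ℓ ∣ a` contradicts `a² + b² = ℓ` with `b ≠ 0`: either `a = 0` and `b² = ℓ` is a prime, or `ℓ² ≤ a² < ℓ`
    obtain ⟨c, hc⟩ := ha
    have hb2 : 0 < b ^ 2 := by positivity
    have hℓ2' : (2 : ℤ) ≤ ℓ := by exact_mod_cast hℓ.two_le
    have key : (ℓ : ℤ) ^ 2 * c ^ 2 + b ^ 2 = ℓ := by rw [hc] at h; linear_combination h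
    rcases eq_or_ne c 0 with rfl | hc0
    · -- `b² = ℓ`
      have hbℓ : b ^ 2 = ℓ := by simpa using key
      have hd2 : (b.natAbs : ℤ) ^ 2 = ℓ := by rw [Int.natAbs_sq b]; exact hbℓ
      have hd : b.natAbs ^ 2 = ℓ := by exact_mod_cast hd2
      rcases hℓ.eq_one_or_self_of_dvd b.natAbs ⟨b.natAbs, by rw [← hd]; ring⟩ with h1 | h1
      · rw [h1] at hd; norm_num at hd; exact hℓ.ne_one hd.symm
      · rw [h1] at hd
        have : ℓ * ℓ = ℓ * 1 := by nlinarith [hd]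
        exact hℓ.ne_one (Nat.eq_of_mul_eq_mul_left hℓ.pos this)
    · have hc2 : 1 ≤ c ^ 2 := by
        rcases Int.ne_iff_lt_or_gt.mp hc0 with hlt | hgt
        · nlinarith
        · nlinarith
      have h4 : (1 : ℤ) ≤ (ℓ : ℤ) * c ^ 2 - 1 := by nlinarith
      nlinarith [mul_le_mul_of_nonneg_left h4 (by linarith : (0 : ℤ) ≤ ℓ)]

/-! ## §3 Valuation certificates at a principal place -/

omit [IsCyclotomicExtension {4} ℚ K] in
/-- **`v(πᵏ y) = k` when `v = (π)` and `y ∉ v`** — in Mathlib's normalisation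
`log (v.valuation K (πᵏ y)) = -k`. [cite: NeukirchANT1999, Ch. I §11 (the `𝔭`-adic exponential valuation)] -/
theorem log_valuation_eq_neg_of_eq_pow_mul {v : HeightOneSpectrum (𝓞 K)} {p x y : 𝓞 K}
    (hv : v.asIdeal = span {p}) (k : ℕ) (hx : x = p ^ k * y) (hy : y ∉ v.asIdeal) :
    WithZero.log (v.valuation K (x : K)) = -(k : ℤ) := by
  have hp0 : p ≠ 0 := by
    intro h0; rw [h0] at hv
    exact v.ne_bot (by rw [hv, span_singleton_eq_bot])
  have hvp : v.intValuation p = WithZero.exp (-1 : ℤ) := v.intValuation_singleton hp0 hv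
  have hvy : v.intValuation y = 1 := HeightOneSpectrum.intValuation_eq_one_iff.mpr hy
  rw [show ((x : 𝓞 K) : K) = algebraMap (𝓞 K) K x from rfl, HeightOneSpectrum.valuation_of_algebraMap, hx,
    map_mul, map_pow, hvp, hvy, mul_one, ← WithZero.exp_nsmul, WithZero.log_exp]
  simp

omit [NumberField K] [IsCyclotomicExtension {4} ℚ K] in
/-- **Membership certificate**: if `y = π z + d` with `π ∈ v`, `d ∈ ℤ`, `ℓ ∈ v` a rational prime and `ℓ ∤ d`,
then `y ∉ v`. [cite: NeukirchANT1999, Ch. I §3] -/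
theorem not_mem_of_eq_mul_add_intCast {v : HeightOneSpectrum (𝓞 K)} {p y z : 𝓞 K} {d : ℤ} {ℓ : ℕ}
    (hℓ : ℓ.Prime) (hℓv : (ℓ : 𝓞 K) ∈ v.asIdeal) (hp : p ∈ v.asIdeal) (hy : y = p * z + d)
    (hd : ¬ (ℓ : ℤ) ∣ d) : y ∉ v.asIdeal := by
  intro hyv
  have hdv : (d : 𝓞 K) ∈ v.asIdeal := by
    have : (d : 𝓞 K) = y - p * z := by rw [hy]; ring
    rw [this]; exact v.asIdeal.sub_mem hyv (v.asIdeal.mul_mem_right _ hp)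
  exact hd (natCast_dvd_of_intCast_mem hℓ hℓv hdv)

omit [NumberField K] [IsCyclotomicExtension {4} ℚ K] in
/-- A rational integer prime to `ℓ` lies outside every place above `ℓ`. [cite: NeukirchANT1999, Ch. I §3] -/
theorem intCast_not_mem_of_not_dvd {v : HeightOneSpectrum (𝓞 K)} {ℓ : ℕ} (hℓ : ℓ.Prime)
    (hℓv : (ℓ : 𝓞 K) ∈ v.asIdeal) {w : ℤ} (hw : ¬ (ℓ : ℤ) ∣ w) : (w : 𝓞 K) ∉ v.asIdeal :=
  fun h ↦ hw (natCast_dvd_of_intCast_mem hℓ hℓv h)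

/-- **Integers at an inert place**: for a prime `q ≡ 3 (mod 4)` and the place `v ∋ q` (`v = (q)`),
`v(qᵏ w) = k` for `q ∤ w`. [cite: IrelandRosen1982, Ch. 9 §7 Lemma 4] -/
theorem log_valuation_intCast_of_inert {v : HeightOneSpectrum (𝓞 K)} {q : ℕ} (hq : q.Prime)
    (hq3 : q % 4 = 3) (hqv : (q : 𝓞 K) ∈ v.asIdeal) (k : ℕ) {w z : ℤ} (hz : z = (q : ℤ) ^ k * w)
    (hw : ¬ (q : ℤ) ∣ w) : WithZero.log (v.valuation K ((z : 𝓞 K) : K)) = -(k : ℤ) :=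
  log_valuation_eq_neg_of_eq_pow_mul (eq_span_natCast_of_mem_of_mod_four_eq_three hq hq3 v.isPrime hqv) k
    (by rw [hz]; push_cast; ring) (intCast_not_mem_of_not_dvd hq hqv hw)

/-- **Integers at a split place**: for `v = (a + bζ)` with `ℓ = a² + b²` an odd prime, `v(ℓᵏ w) = k` for `ℓ ∤ w`
(`ℓᵏ w = (a + bζ)ᵏ · ((a - bζ)ᵏ w)` and `a - bζ, w ∉ v`). [cite: IrelandRosen1982, Ch. 9 §7 Lemma 5] -/
theorem log_valuation_intCast_of_split (hζ : IsPrimitiveRoot ζ 4) {v : HeightOneSpectrum (𝓞 K)} {a b : ℤ}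
    {ℓ : ℕ} (hℓ : ℓ.Prime) (hℓ2 : ℓ ≠ 2) (h : a ^ 2 + b ^ 2 = ℓ) (hb : b ≠ 0)
    (hv : v.asIdeal = span {((a : 𝓞 K) + b * ζ)}) (k : ℕ) {w z : ℤ} (hz : z = (ℓ : ℤ) ^ k * w)
    (hw : ¬ (ℓ : ℤ) ∣ w) : WithZero.log (v.valuation K ((z : 𝓞 K) : K)) = -(k : ℤ) := by
  have hsq := sq_add_one_eq_zero hζ
  have hπ : (a : 𝓞 K) + b * ζ ∈ v.asIdeal := by rw [hv]; exact mem_span_singleton_self _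
  have hℓv : (ℓ : 𝓞 K) ∈ v.asIdeal := by
    have e : (ℓ : 𝓞 K) = ((a : 𝓞 K) + b * ζ) * ((a : 𝓞 K) - b * ζ) := by
      have : ((ℓ : ℤ) : 𝓞 K) = (ℓ : 𝓞 K) := by push_cast; rfl
      rw [← this, ← h]; push_cast
      linear_combination ((b : 𝓞 K) ^ 2) * hsq
    rw [e]; exact v.asIdeal.mul_mem_right _ hπ
  have hbar : (a : 𝓞 K) - b * ζ ∉ v.asIdeal := by
    rw [hv]; exact int_sub_int_mul_not_mem_span hζ hℓ hℓ2 h hb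
  have e : (ℓ : 𝓞 K) = ((a : 𝓞 K) + (b : 𝓞 K) * ζ) * ((a : 𝓞 K) - (b : 𝓞 K) * ζ) := by
    have : ((ℓ : ℤ) : 𝓞 K) = (ℓ : 𝓞 K) := by push_cast; rfl
    rw [← this, ← h]; push_cast
    linear_combination ((b : 𝓞 K) ^ 2) * hsq
  refine log_valuation_eq_neg_of_eq_pow_mul hv k (y := ((a : 𝓞 K) - (b : 𝓞 K) * ζ) ^ k * (w : 𝓞 K)) ?_ ?_
  · rw [hz]; push_cast; rw [e, mul_pow]; ring
  · intro hmem
    rcases v.isPrime.mem_or_mem hmem with h1 | h1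
    · exact hbar ((v.isPrime.pow_mem_iff_mem k (Nat.pos_of_ne_zero (by
        rintro rfl; simp at h1; exact v.isPrime.ne_top ((Ideal.eq_top_iff_one _).mpr h1)))).mp h1)
    · exact intCast_not_mem_of_not_dvd hℓ hℓv hw h1

/-- **Integers at the ramified place**: for the place `v ∋ 2` (`v = (1 + ζ)`, `2 = -ζ(1 + ζ)²`),
`v(2ᵏ w) = 2k` for odd `w`. [cite: IrelandRosen1982, Ch. 9 §7 Lemma 3] -/
theorem log_valuation_intCast_of_two (hζ : IsPrimitiveRoot ζ 4) {v : HeightOneSpectrum (𝓞 K)}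
    (h2v : (2 : 𝓞 K) ∈ v.asIdeal) (k : ℕ) {w z : ℤ} (hz : z = 2 ^ k * w) (hw : ¬ (2 : ℤ) ∣ w) :
    WithZero.log (v.valuation K ((z : 𝓞 K) : K)) = -((2 * k : ℕ) : ℤ) := by
  have hsq := sq_add_one_eq_zero hζ
  have e2 : (2 : 𝓞 K) = -ζ * ((1 : 𝓞 K) + ζ) ^ 2 := by linear_combination (2 + ζ) * hsq
  have hl : (1 : 𝓞 K) + ζ ∈ v.asIdeal := by
    have : ((1 : 𝓞 K) + ζ) ^ 2 ∈ v.asIdeal := by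
      have e : ((1 : 𝓞 K) + ζ) ^ 2 = ζ * 2 := by linear_combination hsq
      rw [e]; exact v.asIdeal.mul_mem_left _ h2v
    exact (v.isPrime.pow_mem_iff_mem 2 (by norm_num)).mp this
  have hv : v.asIdeal = span {(1 : 𝓞 K) + ζ} := asIdeal_eq_span_of_prime_mem (prime_one_add_four hζ) hl
  have h2v' : ((2 : ℕ) : 𝓞 K) ∈ v.asIdeal := by exact_mod_cast h2v
  refine log_valuation_eq_neg_of_eq_pow_mul hv (2 * k) (y := (-ζ) ^ k * (w : 𝓞 K)) ?_ ?_
  · rw [hz]; push_cast; rw [e2, mul_pow, ← pow_mul]; ring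
  · intro hmem
    rcases v.isPrime.mem_or_mem hmem with h1 | h1
    · -- `ζ` is a unit
      have hζu : IsUnit ζ := hζ.isUnit (by norm_num)
      have hζmem : ζ ∈ v.asIdeal := by
        have := (v.isPrime.pow_mem_iff_mem k (Nat.pos_of_ne_zero (by
          rintro rfl; simp at h1; exact v.isPrime.ne_top ((Ideal.eq_top_iff_one _).mpr h1)))).mp h1
        simpa using v.asIdeal.neg_mem_iff.mp (by simpa using this)
      exact v.isPrime.ne_top (v.asIdeal.eq_top_of_isUnit_mem hζmem hζu)
    · exact intCast_not_mem_of_not_dvd Nat.prime_two h2v' (by exact_mod_cast hw) h1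

/-! ## §4 No fifth roots of unity in `ℚ(i)` -/

/-- **`ℚ(i)` contains no primitive fifth root of unity** (its roots of unity are `±1, ±i`: `w = 4`).
[cite: IrelandRosen1982, Ch. 9 §7 (the units of `ℤ[i]` are `±1, ±i`)] -/
theorem not_isPrimitiveRoot_five_four (x : K) : ¬ IsPrimitiveRoot x 5 := by
  intro hx
  -- `x` is a unit of `𝓞 K` of finite order, i.e. lies in the torsion, a group of order `w = 4`
  haveI : NeZero (5 : ℕ) := ⟨by norm_num⟩
  have hx' : IsPrimitiveRoot hx.toInteger 5 := hx.toInteger_isPrimitiveRoot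
  set w : (𝓞 K)ˣ := (hx'.isUnit (by norm_num)).unit with hw
  have hwval : (w : 𝓞 K) = hx.toInteger := IsUnit.unit_spec _
  have hw5 : w ^ 5 = 1 := by
    apply Units.ext
    rw [Units.val_pow_eq_pow_val, hwval, hx'.pow_eq_one, Units.val_one]
  have htors : w ∈ NumberField.Units.torsion K := by
    rw [NumberField.Units.torsion, CommGroup.mem_torsion]
    exact isOfFinOrder_iff_pow_eq_one.mpr ⟨5, by norm_num, hw5⟩
  have hord4 : orderOf (⟨w, htors⟩ : NumberField.Units.torsion K) ∣ 4 := by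
    rw [← torsionOrder_eq_four (K := K)]
    exact orderOf_dvd_natCard _
  have hord5 : orderOf (⟨w, htors⟩ : NumberField.Units.torsion K) ∣ 5 :=
    orderOf_dvd_of_pow_eq_one (Subtype.ext hw5)
  have h1 : orderOf (⟨w, htors⟩ : NumberField.Units.torsion K) = 1 := by
    have := Nat.dvd_gcd hord4 hord5
    simpa using this
  rw [orderOf_eq_one_iff] at h1
  have hw1 : w = 1 := congrArg Subtype.val h1
  have hx1 : x = 1 := by
    have e : ((w : 𝓞 K) : K) = x := by rw [hwval]; rfl
    rw [← e, hw1]; rfl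
  exact hx.ne_one (by norm_num) hx1

end Four

end Literature.NumberTheory.NumberFields

end
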